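import Summits.ABC.ABC.Theses.IneffectiveSubspace
import Literature.NumberTheory.DiophantineGeometry.AbcImpliesHall

/-!
# Stub `PolyAbcOfFlatBound` of the line `binomial-xi-d-zero-threefold` (crux stmt-ABC-1647)

Vojta's canonical lift at the top coordinate (Vojta 2000, §3.1), for ONE level `n ≥ 1`:
the "flat bound" at level `n` — `wZⁿ ≤ K·(uvw)^κ` on positive solutions of `uXⁿ + vYⁿ = wZⁿ` with
`gcd(uXⁿ, vYⁿ) = 1` — implies POLYNOMIAL abc, `c < C·rad(abc)^κ'` for all abc triples.

Proof. Write each member `m` of an abc triple `(a, b, c)` as `m = u(m)·X(m)ⁿ` with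
`X(m) = ∏ p^⌊v_p(m)/n⌋`, `u(m) = ∏ p^(v_p(m) mod n)`; then `u(m) ∣ rad(m)^(n−1)` (all exponents are
`≤ n − 1`). The flat bound applied to `(u(a), u(b), u(c), X(a), X(b), X(c))` (its equation is `a + b = c`,
its coprimality that of the triple) gives `c ≤ K·(u(a)u(b)u(c))^κ`, and
`u(a)u(b)u(c) ≤ (rad a · rad b · rad c)^(n−1) = rad(abc)^(n−1)` by pairwise coprimality, whence
`c ≤ K·rad(abc)^((n−1)·max κ 0) < (K+1)·rad(abc)^((n−1)·max κ 0)`; `K > 0` because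
`(u,v,w,X,Y,Z) = (1,1,2,1,1,1)` is a solution.

This file supports `stmt-ABC-1647`: its main theorem `stub_polyAbcOfFlatBound` is, verbatim, the
registered stub of the skeleton of the line (statement `PolyAbcOfFlatBound` with both sides unfolded).
-/

-- `Summit.<Summit>.<Problem>` is the mandated summit-side namespace (CONVENTIONS §2); for the
-- single-conjunct summit `ABC` the two coincide, so the duplicate `ABC.ABC` is deliberate.
set_option linter.dupNamespace false

namespace Summit.ABC.ABC.Theorems

open scoped BigOperators
open Literature.NumberTheory.DiophantineGeometry

/-- **`n`-th-power-free decomposition.** For `n ≥ 1` and `m ≠ 0` there are `u, X ≥ 1` with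
`u · Xⁿ = m` and `u ∣ rad(m)^(n−1)`: take `X = ∏ p^⌊v_p(m)/n⌋` and `u = ∏ p^(v_p(m) mod n)` over the
primes `p ∣ m`. [cite: Vojta2000ABC, §3.1] -/
theorem PolyAbcOfFlatBound.nthPowerFreeDecomp {n : ℕ} (hn : 1 ≤ n) {m : ℕ} (hm : m ≠ 0) :
    ∃ u X : ℕ, 0 < u ∧ 0 < X ∧ u * X ^ n = m ∧
      u ∣ (UniqueFactorizationMonoid.radical m) ^ (n - 1) := by
  have hprime : ∀ p ∈ m.primeFactors, p.Prime := fun p hp => Nat.prime_of_mem_primeFactors hp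
  refine ⟨∏ p ∈ m.primeFactors, p ^ (m.factorization p % n),
    ∏ p ∈ m.primeFactors, p ^ (m.factorization p / n), ?_, ?_, ?_, ?_⟩
  · exact Finset.prod_pos fun p hp => pow_pos (hprime p hp).pos _
  · exact Finset.prod_pos fun p hp => pow_pos (hprime p hp).pos _
  · -- `∏ p^(e mod n) · (∏ p^⌊e/n⌋)ⁿ = ∏ p^e = m`
    rw [← Finset.prod_pow, ← Finset.prod_mul_distrib]
    have key : ∀ p ∈ m.primeFactors,
        p ^ (m.factorization p % n) * (p ^ (m.factorization p / n)) ^ n =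
          p ^ (m.factorization p) := fun p _ => by
      rw [← pow_mul', ← pow_add, Nat.mod_add_div]
    rw [Finset.prod_congr rfl key]
    conv_rhs => rw [← Nat.prod_factorization_pow_eq_self hm,
      Nat.prod_factorization_eq_prod_primeFactors]
  · -- every exponent `e mod n` is `≤ n - 1`
    rw [Nat.radical_eq_prod_primeFactors, ← Finset.prod_pow]
    exact Finset.prod_dvd_prod_of_dvd _ _ fun p _ =>
      pow_dvd_pow p (Nat.le_sub_one_of_lt (Nat.mod_lt _ hn))

-- adapted from Cruxes/TowerExponentWindow/Disproof.lean (`radical_mul_three_of_triple`)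
/-- `rad(a) · rad(b) · rad(c) = rad(abc)` for an abc triple (pairwise coprimality). [folklore] -/
theorem PolyAbcOfFlatBound.radical_mul_three_of_triple {a b c : ℕ} (h : IsABCTriple a b c) :
    UniqueFactorizationMonoid.radical a * UniqueFactorizationMonoid.radical b *
      UniqueFactorizationMonoid.radical c = rad a b c := by
  obtain ⟨-, -, hsum, hcop⟩ := h
  have hac : Nat.Coprime a c := by rw [← hsum]; exact Nat.coprime_self_add_right.mpr hcop
  have hbc : Nat.Coprime b c := by rw [← hsum]; exact Nat.coprime_add_self_right.mpr hcop.symm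
  rw [rad_def,
    UniqueFactorizationMonoid.radical_mul (Nat.coprime_iff_isRelPrime.mp (Nat.Coprime.mul_left hac hbc)),
    UniqueFactorizationMonoid.radical_mul (Nat.coprime_iff_isRelPrime.mp hcop)]

/-- **Stub C of the line `binomial-xi-d-zero-threefold` · `PolyAbcOfFlatBound`** (Vojta's canonical
lift at the top coordinate). For `n ≥ 1`, the flat bound at level `n` (`wZⁿ ≤ K·(uvw)^κ` on positive
solutions of `uXⁿ + vYⁿ = wZⁿ` with `gcd(uXⁿ, vYⁿ) = 1`) implies polynomial abc: there are `κ'` and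
`C > 0` with `c < C·rad(abc)^κ'` for every abc triple `(a, b, c)`; in fact `κ' = (n − 1)·max κ 0` and
`C = K + 1`. Registered form: the statement is verbatim the skeleton's `stub_polyAbcOfFlatBound`.
[cite: Vojta2000ABC, §3.1] -/
theorem stub_polyAbcOfFlatBound : ∀ n : ℕ, 1 ≤ n → (∃ κ K : ℝ, ∀ u v w X Y Z : ℕ, 0 < u → 0 < v → 0 < w → 0 < X → 0 < Y → 0 < Z → u * X ^ n + v * Y ^ n = w * Z ^ n → Nat.Coprime (u * X ^ n) (v * Y ^ n) → ((w * Z ^ n : ℕ) : ℝ) ≤ K * ((u * v * w : ℕ) : ℝ) ^ κ) → ∃ κ C : ℝ, 0 < C ∧ ∀ a b c : ℕ, Literature.NumberTheory.DiophantineGeometry.IsABCTriple a b c → (c : ℝ) < C * ((Literature.NumberTheory.DiophantineGeometry.rad a b c : ℕ) : ℝ) ^ κ := by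
  intro n hn hflat
  obtain ⟨κ, K, hK⟩ := hflat
  -- (0) `K > 0`: `(u, v, w, X, Y, Z) = (1, 1, 2, 1, 1, 1)` solves `1·1ⁿ + 1·1ⁿ = 2·1ⁿ`
  have hKpos : 0 < K := by
    have h := hK 1 1 2 1 1 1 one_pos one_pos two_pos one_pos one_pos one_pos
      (by norm_num) (by rw [one_pow, one_mul]; exact Nat.coprime_one_left 1)
    have h2 : (0 : ℝ) < ((1 * 1 * 2 : ℕ) : ℝ) ^ κ := Real.rpow_pos_of_pos (by norm_num) _
    have h3 : (0 : ℝ) < ((2 * 1 ^ n : ℕ) : ℝ) := by positivity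
    exact pos_of_mul_pos_left (h3.trans_le h) h2.le
  refine ⟨((n - 1 : ℕ) : ℝ) * max κ 0, K + 1, by linarith, ?_⟩
  intro a b c habc
  obtain ⟨ha, hb, hsum, hcop⟩ := habc
  have hc : 0 < c := by omega
  -- (1) the `n`-th-power-free decompositions of `a`, `b`, `c`
  obtain ⟨u, X, hu, hX, haX, hua⟩ := PolyAbcOfFlatBound.nthPowerFreeDecomp hn ha.ne'
  obtain ⟨v, Y, hv, hY, hbY, hvb⟩ := PolyAbcOfFlatBound.nthPowerFreeDecomp hn hb.ne'
  obtain ⟨w, Z, hw, hZ, hcZ, hwc⟩ := PolyAbcOfFlatBound.nthPowerFreeDecomp hn hc.ne'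
  -- (2) the flat bound at `(u, v, w, X, Y, Z)`
  have hmain := hK u v w X Y Z hu hv hw hX hY hZ (by rw [haX, hbY, hcZ]; exact hsum)
    (by rw [haX, hbY]; exact hcop)
  rw [hcZ] at hmain
  -- (3) radical bookkeeping in `ℕ`: `uvw ≤ rad(abc)^(n-1)`
  have hrad3 := PolyAbcOfFlatBound.radical_mul_three_of_triple ⟨ha, hb, hsum, hcop⟩
  have huvw : u * v * w ≤ rad a b c ^ (n - 1) := by
    rw [← hrad3, mul_pow, mul_pow]
    exact Nat.le_of_dvd (by positivity) (mul_dvd_mul (mul_dvd_mul hua hvb) hwc)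
  -- (4) the real side
  set R : ℝ := ((rad a b c : ℕ) : ℝ) with hRdef
  have hR1 : (1 : ℝ) ≤ R := by
    rw [hRdef]; exact_mod_cast Nat.succ_le_of_lt (Nat.radical_pos (a * b * c))
  have hR0 : (0 : ℝ) ≤ R := zero_le_one.trans hR1
  have hP1 : (1 : ℝ) ≤ ((u * v * w : ℕ) : ℝ) := by
    exact_mod_cast Nat.succ_le_of_lt (Nat.mul_pos (Nat.mul_pos hu hv) hw)
  have hPR : ((u * v * w : ℕ) : ℝ) ≤ R ^ (n - 1) := by rw [hRdef]; exact_mod_cast huvw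
  have hθ0 : (0 : ℝ) ≤ max κ 0 := le_max_right _ _
  have step1 : ((u * v * w : ℕ) : ℝ) ^ κ ≤ ((u * v * w : ℕ) : ℝ) ^ (max κ 0) :=
    Real.rpow_le_rpow_of_exponent_le hP1 (le_max_left _ _)
  have step2 : ((u * v * w : ℕ) : ℝ) ^ (max κ 0) ≤ (R ^ (n - 1)) ^ (max κ 0) :=
    Real.rpow_le_rpow (zero_le_one.trans hP1) hPR hθ0
  have step3 : (R ^ (n - 1)) ^ (max κ 0) = R ^ (((n - 1 : ℕ) : ℝ) * max κ 0) := by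
    rw [Real.rpow_mul hR0, Real.rpow_natCast]
  have hpow : 0 < R ^ (((n - 1 : ℕ) : ℝ) * max κ 0) :=
    Real.rpow_pos_of_pos (zero_lt_one.trans_le hR1) _
  calc ((c : ℕ) : ℝ) ≤ K * ((u * v * w : ℕ) : ℝ) ^ κ := hmain
    _ ≤ K * R ^ (((n - 1 : ℕ) : ℝ) * max κ 0) := by
        rw [← step3]; exact mul_le_mul_of_nonneg_left (step1.trans step2) hKpos.le
    _ < (K + 1) * R ^ (((n - 1 : ℕ) : ℝ) * max κ 0) := by
        rw [add_one_mul]; exact lt_add_of_pos_right _ hpow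

end Summit.ABC.ABC.Theorems
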